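import Summits.BirchSwinnertonDyer.BirchSwinnertonDyer.Theorems.ErratumRoadFiveIMCDivRoadFFFittingCutB
import HarnessLib

/-!
# Route `ErratumRoadFive` (rung K2, `p ≥ 5`), crux `IMCDivAtErratumDataAllR` (item stmt-BirchSwinnertonDyer-20169):
# the Fitting-level (non-printed) feeder of the TWO-SLOT congruence frame — members over their own `𝒪_m` with
# (2.5)_m as a FITTING-ideal inclusion

Cell `bsd-stepL` (run/shared/lean/pub/bsd-stepL/), seat `bsd-stepL-imc-p1` (prover g9, 2026-08-27); `--supports
stmt-BirchSwinnertonDyer-20169 --as helper`; Theses-free (imports this seat's `ErratumRoadFiveIMCDivRoadFFFittingCutB`, p495387).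
WHY: the typer's member bundle (defn-ty1 g3 (T3), MEMBER-FACTS-DESIGN (r3)) may state (2.5)_m = FW21 Thm. 4.41 either in its
PRINTED shape (`N_m` torsion → `Ch_{R'_m}(N_m)·S'_m ⊆ (L_m)`, consumed by p495387's
`P2.RoadFF.fittingCongruenceFrameTwoSlotAt_of_members_descent_le_printed`, which needs `R'_m` a Noetherian UFD) or at
FITTING level (`Fitt_{R'_m}(N_m)·S'_m ⊆ (L_m)`, weaker hypotheses on `R'_m`: any commutative ring). This file supplies the
Fitting-level two-slot feeder — p490889's `P2.RoadFF.fittingCongruenceFrameAt_of_members_descent_le` with the frame at `𝔭`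
and the members comparing with `X^Σ` STRICT AT `𝔮` (the descent `AcSelmer.XAc.map_fittingIdeal_le_span_of_oneSided_
congruences_descent_le`, p489585, is frame-blind). THEOREMS ONLY; no definition, no named fact, no `sorry`; nothing booked.

References: [Castella2018Erratum] (b), (c), Lemma 2.1, (2.5), proof of Thm. 1.1 (pp. 2–4); [Castella2018] Thm. 3.1, (3.1)
(arXiv:1704.06608 p. 9); [Skinner2016PacificMC] §3.1 (p. 192); [FouquetWan2021] Thm. 4.41 (PREPRINT; shape only).
-/

set_option autoImplicit false

noncomputable section

open scoped Classical TensorProduct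

open WeierstrassCurve NumberField IsDedekindDomain Field PowerSeries
open Literature.NumberTheory.EllipticCurves Literature.NumberTheory.EllipticCurves.GreenbergSelmer
  Literature.NumberTheory.EllipticCurves.ModularForms Literature.NumberTheory.EllipticCurves.Rank1Residual
  Literature.NumberTheory.EllipticCurves.Rank1Residual.Typed Literature.NumberTheory.EllipticCurves.Castella2018
  Literature.NumberTheory.EllipticCurves.Module Literature.NumberTheory.GaloisRepresentations
  Literature.NumberTheory.GaloisCohomology Literature.RingTheory.FittingIdeal
open Summit.BirchSwinnertonDyer.Rank1Residual.X11b.AcSelmer Summit.BirchSwinnertonDyer.Rank1Residual.X11b.Halves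

namespace Summit.BirchSwinnertonDyer.Rank1Residual.X11b

section Feed

variable {K : Type} [Field K] [NumberField K] {W : WeierstrassCurve ℚ} [W.IsElliptic] {p : ℕ}
  [Fact p.Prime] {κ : ZpExtension K p} {𝔭 𝔮 : HeightOneSpectrum (𝓞 K)} {γ : Field.absoluteGaloisGroup K}
  [Fact (κ.IsTopGenerator γ)] {ι : PadicAlgCl p ≃+* ℂ} {N : ℕ}
  {f : CuspForm (CongruenceSubgroup.Gamma0 N) 2}
  {S : Set (HeightOneSpectrum (𝓞 K))} {PS : IwasawaAlgebra p}

universe v w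

/-- **Hida members with their OWN coefficient rings feed the TWO-SLOT congruence frame, (2.5)_m at FITTING level.** An
`R₀`-frame at the frame prime `𝔭` [Cas18 Thm. 3.1], `L^Σ` with `L·φ(P_Σ) ∣ L^Σ` [Cas18 (3.1)], `Σ` finite, and for every
`m ≥ 1` a coefficient square `Λ → R'_m →(φ'_m) S'_m ← R₀⟦T⟧` (`S'_m` faithfully flat over `R₀⟦T⟧`), a finite `R'_m`-module
`N_m`, an `R'_m`-isomorphism `(R'_m ⊗_Λ X^Σ_𝔮)/p^m ≅ N_m/p^m` [(b) + Lemma 2.1], `Fitt_{R'_m}(N_m)·S'_m ⊆ (L_m)` [(2.5)_m at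
Fitting level — implied by the printed `Ch` form over a Noetherian UFD] and `(L_m) ⊆ (L^Σ) + (p^m)` in `S'_m` [(c)] ⟹
`P2.RoadFF.FittingCongruenceFrameTwoSlotAt W p κ 𝔭 𝔮 γ ι f S PS`. ANY commutative `R'_m`. CONDITIONAL on the displayed inputs.
[cite: Castella2018Erratum, proof of Thm. 1.1 (p. 4), read one-sidedly] [cite: Skinner2016PacificMC, §3.1 (p. 192)] -/
theorem P2.RoadFF.fittingCongruenceFrameTwoSlotAt_of_members_descent_le {ΩK : ℂ} {Ωp : (unrIntegers p)ˣ}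
    {L : UnrSeries p} (hΩ : ΩK ≠ 0)
    (hL : IsBDPLFunction ι 𝔭 κ γ f ΩK ((Ωp : unrIntegers p) : ℂ_[p]) L)
    (LS : UnrSeries p) (hLS : L * PowerSeries.map (toUnr p) PS ∣ LS) (hS : S.Finite)
    (R' : ℕ → Type v) [∀ m, CommRing (R' m)] [∀ m, Algebra (IwasawaAlgebra p) (R' m)]
    (S' : ℕ → Type w) [∀ m, CommRing (S' m)] [∀ m, Algebra (UnrSeries p) (S' m)]
    [∀ m, Module.FaithfullyFlat (UnrSeries p) (S' m)] (φ' : ∀ m, R' m →+* S' m)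
    (hφ' : ∀ m, (φ' m).comp (algebraMap (IwasawaAlgebra p) (R' m)) =
      (algebraMap (UnrSeries p) (S' m)).comp (PowerSeries.map (toUnr p)))
    (Nm : ℕ → Type) [∀ m, AddCommGroup (Nm m)] [∀ m, Module (R' m) (Nm m)]
    [∀ m, Module.Finite (R' m) (Nm m)] (Lm : ∀ m, S' m)
    (e : ∀ m : ℕ, 1 ≤ m →
      (((R' m ⊗[IwasawaAlgebra p] XAc (W.baseChange K) p κ 𝔮 S γ) ⧸
          (((Ideal.span {(PowerSeries.C (p : ℤ_[p]) : IwasawaAlgebra p)}).map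
              (algebraMap (IwasawaAlgebra p) (R' m))) ^ m •
            (⊤ : Submodule (R' m) (R' m ⊗[IwasawaAlgebra p] XAc (W.baseChange K) p κ 𝔮 S γ))))
          ≃ₗ[R' m]
        (Nm m ⧸ (((Ideal.span {(PowerSeries.C (p : ℤ_[p]) : IwasawaAlgebra p)}).map
            (algebraMap (IwasawaAlgebra p) (R' m))) ^ m • (⊤ : Submodule (R' m) (Nm m))))))
    (hF : ∀ m : ℕ, 1 ≤ m → (Module.fittingIdeal (R' m) (Nm m) 0).map (φ' m) ≤ Ideal.span {Lm m})
    (hc : ∀ m : ℕ, 1 ≤ m →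
      Ideal.span {Lm m} ≤
        Ideal.span {algebraMap (UnrSeries p) (S' m) LS} ⊔
          (((Ideal.span {(PowerSeries.C (p : ℤ_[p]) : IwasawaAlgebra p)}).map
              (PowerSeries.map (toUnr p))).map (algebraMap (UnrSeries p) (S' m))) ^ m) :
    P2.RoadFF.FittingCongruenceFrameTwoSlotAt W p κ 𝔭 𝔮 γ ι f S PS :=
  ⟨ΩK, Ωp, L, LS, hΩ, hL, hLS,
    AcSelmer.XAc.map_fittingIdeal_le_span_of_oneSided_congruences_descent_le (W.baseChange K) p κ 𝔮 γ
      hS LS R' S' φ' hφ' Nm Lm e hF hc⟩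

end Feed

end Summit.BirchSwinnertonDyer.Rank1Residual.X11b

end
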